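import Summits.PneNP.PneNP.Theses.MonochromaticLines
import Literature.Computability.Complexity.SearchToDecision
import Literature.Computability.Complexity.TM2PassThrough

/-!
# Route MonochromaticLines — `Assembly` (stmt-PneNP-11763)

The TFNP pattern: under `NP ⊆ P`, the `P`-checkable (`MonoLineCheckable`) and total (`MonoLineTotal`) relation
"`w` codes a monochromatic combinatorial line of the instance `I`" has a polynomial-time solver: search reduces to
decision (`exists_searchFn_of_NP_subset_P`, witness bound `10·|x| + 20`, since a line `(x,y,z)` with `x,y,z < 3ⁿ` codes in
`≤ 10n + 9` bits and the instance code starts with `1ⁿ`), and precomposing the `FP` search function with the instance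
encoding is polynomial-time w.r.t. that encoding by definition.
-/

set_option linter.dupNamespace false -- `Summit.PneNP.PneNP.…`: summit = sub-problem name (D-0017 single-conjunct layout)

namespace Summit.PneNP.PneNP.Theorems

open Polynomial
open Literature.Computability.Complexity Computability

/-- **Assembly item of route MonochromaticLines (stmt-PneNP-11763)**: `MonoLineTotal → MonoLineCheckable → NP ⊆ P →`
a polynomial-time (w.r.t. the instance code) solver printing a monochromatic line of every valid instance.
[cite: AroraBarakCC2009, Thm. 2.18] [folklore] -/
theorem monochromaticLines_assembly_proof : Summit.PneNP.PneNP.Theses.MonochromaticLines.Assembly := by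
  unfold Summit.PneNP.PneNP.Theses.MonochromaticLines.Assembly Summit.PneNP.PneNP.Theses.MonochromaticLines.MonoLineTotal
    Summit.PneNP.PneNP.Theses.MonochromaticLines.MonoLineCheckable
  intro IsLine col Valid dec SolStr wire code encI hT hC hNP
  dsimp only at hT hC
  obtain ⟨R, hR, hRiff⟩ := hC
  obtain ⟨g, hg, hspec⟩ := exists_searchFn_of_NP_subset_P hNP hR (10 * X + 20)
  refine ⟨fun I => g (encI I), fun I hI => ?_, ?_⟩
  · have hI' : 200 ≤ I.1 ∧ ∀ j : Fin (I.1 / 10), ∀ gt ∈ (I.2 j).gates, gt.arity ≤ 2 := hI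
    obtain ⟨x, y, z, hline, hc1, hc2⟩ := hT I.1 hI'.1 (col I)
    set w : List Bool := boolPair (encodeNat x) (boolPair (encodeNat y) (encodeNat z)) with hw
    have hsol : SolStr I w := by
      simp only [SolStr, dec, hw, boolUnpair_boolPair, decode_encodeNat]
      exact ⟨hline, hc1, hc2⟩
    -- length of the witness
    have hlog : ∀ t : ℕ, t < 3 ^ I.1 → (encodeNat t).length ≤ 2 * I.1 + 1 := by
      intro t ht
      refine (TM2Pass.length_encodeNat_le t).trans ?_
      have h34 : 3 ^ I.1 ≤ 2 ^ (2 * I.1) := by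
        rw [pow_mul]
        exact Nat.pow_le_pow_left (by norm_num) _
      rcases Nat.eq_zero_or_pos t with rfl | htpos
      · simp
      · have : Nat.log 2 t < 2 * I.1 := Nat.log_lt_of_lt_pow htpos.ne' (ht.trans_le h34)
        omega
    obtain ⟨hx, hy, hz, -⟩ := hline
    have hlen : w.length ≤ (10 * X + 20 : Polynomial ℕ).eval (encI I).length := by
      have ex := hlog x hx
      have ey := hlog y hy
      have ez := hlog z hz
      have hI1 : 2 * I.1 ≤ (encI I).length := by
        simp only [encI, length_boolPair]
        have := unary_decode_encode_nat I.1
        change (unaryEncodeNat I.1).length = I.1 at this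
        omega
      simp only [hw, length_boolPair, eval_add, eval_mul, eval_ofNat, eval_X]
      omega
    have hmem : boolPair (encI I) w ∈ R := (hRiff I hI w).2 hsol
    have hres := hspec (encI I) ⟨w, hlen, hmem⟩
    exact (hRiff I hI _).1 hres.2
  · obtain ⟨p, M, hM⟩ := hg
    exact ⟨p, M, fun I => hM (encI I)⟩

end Summit.PneNP.PneNP.Theorems
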